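import Summits.QuantumAdvantage.QuantumAdvantage.Theorems.WbwObfuscatedGluedTreesKowPhPrograms
import Summits.QuantumAdvantage.QuantumAdvantage.Theorems.WbwObfuscatedGluedTreesKowNbrPrp

/-!
# `WbwObfuscatedGluedTrees` (stmt-QuantumAdvantage-2340) — line `knowledge-of-walk-split`, STAGE 7 (the PRF hybrid):
# semantics of the layer-B program (registered stub `stub_primSem`)

The adaptive straight-line program `primQ` / `primOut` of `KowPhPrograms` §4 (four table lookups through an
arbitrary oracle `O`) computes EXACTLY the generator's own primitives over the table scheme of the tables read off
the oracle, `primSpec μ d (tabOf μ O)`: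

* ENCRYPT `0 0 ℓ`: lookup 0 is the tag `T₀(fit μ ℓ)`, lookup 1 the mask `T₁(tag)`; the output
  `tag ++ (ℓ ⊕ mask)` is `sivEnc (tabScheme T) μ (tkey 0) (tkey 1) ℓ` (`prf_tabScheme`, `ofFn_vecOf`, `fit_fit`);
* RECOGNISE `0 1 y`: the honest SIV decision procedure (unmask with `T₁(y ↾ μ)`, recompute the tag of the candidate
  label, test that it is a well-formed label: `isLabelB_iff`) agrees with the classical recogniser `unname` by
  `unname_eq_some_iff` / `unname_eq_none_iff` (`dec_eq_of'`, the argument of toolkit `NbrBitFP` piece G1b);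
* PERMUTATION `1 inv tb w`: the four answers fold (`prpFold`) to the four list-level Feistel rounds of
  `prp (tabScheme T) μ (tkey (2 + tb)) d` at `fit d w`, forward or — every round being an involution — in reverse
  order for the inverse (`prpKit_ofFn_prp`, `prpKit_ofFn_prp_symm` of toolkit `NbrBitFP` piece G2a);
* every other body: `[]` on both sides.

[folklore] (SIV decryption by recomputation: Goldreich2004FoC2 Construction 5.4.19; Feistel rounds: LubyRackoff1988).
-/

set_option linter.dupNamespace false

noncomputable section

namespace Summit.QuantumAdvantage.QuantumAdvantage.Theorems.WbwObfuscatedGluedTrees.KnowledgeOfWalk.PrfHybrid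

open Literature.Computability.Complexity Literature.Computability.QuantumComplexity
open Literature.Computability.QuantumComplexity.GluedTrees
open Literature.Computability.Cryptography Literature.Computability.Cryptography.ObfuscatedGluedTrees
open Summit.QuantumAdvantage.QuantumAdvantage.Theorems.WbwObfuscatedGluedTrees.KnowledgeOfWalk.BlackBox
open Summit.QuantumAdvantage.QuantumAdvantage.Theorems.WbwObfuscatedGluedTrees.KnowledgeOfWalk.RealIdeal
open Summit.QuantumAdvantage.QuantumAdvantage.Theorems.WbwObfuscatedGluedTrees.KnowledgeOfWalk.Generator
open _root_.Computability

/-- Four program steps, unfolded. [folklore] -/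
private theorem progAnswers_four {α : Type} (Q : α → List (List Bool) → List Bool) (O : Oracle) (a : α) :
    progAnswers Q O a 4 =
      [O (Q a []), O (Q a [O (Q a [])]), O (Q a [O (Q a []), O (Q a [O (Q a [])])]),
        O (Q a [O (Q a []), O (Q a [O (Q a [])]), O (Q a [O (Q a []), O (Q a [O (Q a [])])])])] :=
  rfl

/-- The fitted PRF of the table scheme of the tables read off `O`. [folklore] -/
private theorem prf_tabOf (μ : ℕ) (O : Oracle) (i : Fin 4) (m : ℕ) (x : List Bool) :
    prf (tabScheme (tabOf μ O)) μ (tkey i) m x = fit m (fit μ (O (tkey i ++ fit μ x))) := by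
  rw [prf_tabScheme, tabOf_tab, ofFn_vecOf, ofFn_vecOf]

/-- The tag of the table scheme. [folklore] -/
private theorem tag_tabOf (μ : ℕ) (O : Oracle) (x : List Bool) :
    tag (tabScheme (tabOf μ O)) μ (tkey 0) x = fit μ (O (tkey 0 ++ fit μ x)) := by
  rw [tag, prf_tabOf, fit_fit le_rfl]

/-- The round schedule, forward. [folklore] -/
private theorem prpRound_false (d : ℕ) :
    prpRound d false 0 = (0, maskLow d) ∧ prpRound d false 1 = (1, maskHigh d) ∧
      prpRound d false 2 = (2, maskLow d) ∧ prpRound d false 3 = (3, maskHigh d) :=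
  ⟨rfl, rfl, rfl, rfl⟩

/-- The round schedule, inverse. [folklore] -/
private theorem prpRound_true (d : ℕ) :
    prpRound d true 0 = (3, maskHigh d) ∧ prpRound d true 1 = (2, maskLow d) ∧
      prpRound d true 2 = (1, maskHigh d) ∧ prpRound d true 3 = (0, maskLow d) :=
  ⟨rfl, rfl, rfl, rfl⟩

/-- The lower-half mask list is `maskLow`. [folklore] -/
private theorem ofFn_lowHalf_eq (d : ℕ) : List.ofFn (lowHalf d) = maskLow d := prpKit_ofFn_lowHalf d

/-- The upper-half mask list is `maskHigh`. [folklore] -/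
private theorem ofFn_highHalf_eq (d : ℕ) : List.ofFn (highHalf d) = maskHigh d := prpKit_ofFn_highHalf d

/-- **ENCRYPT**: two lookups (tag, mask) and `tag ++ (ℓ ⊕ mask)` is `sivEnc` over the table scheme.
[cite: Goldreich2004FoC2, Constructions 5.3.9 and 5.4.19] -/
private theorem enc_case (μ d : ℕ) (O : Oracle) (ℓ : List Bool) :
    runProg (fun a : (ℕ × ℕ) × List Bool => primQ a.1.1 a.1.2 a.2) (fun a => primOut a.1.1 a.1.2 a.2) 4 O
        ((μ, d), false :: false :: ℓ) = primSpec μ d (tabOf μ O) (false :: false :: ℓ) := by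
  simp only [runProg, progAnswers_four, primQ, primOut, primSpec, List.length_nil, List.length_cons,
    List.getD_cons_zero, List.getD_cons_succ, ↓reduceIte, zero_add, Nat.reduceEqDiff]
  rw [sivEnc, tag_tabOf, prf_tabOf, fit_fit le_rfl]

/-- Reading the bits of `⟦l⟧` back gives `l`: `bitsOf |l| ⟦l⟧ = l`. [folklore] -/
private theorem bitsOf_bitsToNat {w : ℕ} {l : List Bool} (h : l.length = w) : bitsOf w (bitsToNat l) = l := by
  subst h
  refine List.ext_getElem (by simp) fun t h₁ h₂ => ?_
  simp only [bitsOf, List.getElem_ofFn, Com.testBit_bitsToNat, List.getD_eq_getElem?_getD,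
    List.getElem?_eq_getElem h₂, Option.getD_some]

/-- `⟦bitsOf w m⟧ = m` for `m < 2^w`. [folklore] -/
private theorem bitsToNat_bitsOf {w m : ℕ} (hm : m < 2 ^ w) : bitsToNat (bitsOf w m) = m :=
  bitsOf_injOn w (by simpa using bitsToNat_lt (bitsOf w m)) hm (bitsOf_bitsToNat (length_bitsOf w m))

/-- **The Boolean label test is correct**: `isLabelB d x` holds iff `x` is the label of a vertex of `G'_d`
(adapted from the label test of toolkit `NbrBitFP`, piece G1b). [folklore] -/
private theorem isLabelB_iff (d : ℕ) (x : List Bool) : isLabelB d x = true ↔ ∃ v, label d v = x := by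
  simp only [isLabelB, Bool.and_eq_true, decide_eq_true_eq]
  constructor
  · rintro ⟨⟨hl, hj⟩, hi⟩
    obtain ⟨s, r, rfl⟩ : ∃ s r, x = s :: r := by
      cases x with
      | nil => simp [labelLen] at hl
      | cons s r => exact ⟨s, r, rfl⟩
    simp only [List.length_cons, List.drop_succ_cons, List.drop_zero, labelLen] at hl hj hi
    have hJ : (r.take (d + 1)).length = d + 1 := by rw [List.length_take]; omega
    have hI : (r.drop (d + 1)).length = d + 1 := by rw [List.length_drop]; omega
    rw [List.take_of_length_le (le_of_eq hI)] at hi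
    refine ⟨(s, ⟨⟨bitsToNat (r.take (d + 1)), Nat.lt_succ_of_le hj⟩, ⟨bitsToNat (r.drop (d + 1)), hi⟩⟩), ?_⟩
    change s :: (bitsOf (d + 1) (bitsToNat (r.take (d + 1))) ++ bitsOf (d + 1) (bitsToNat (r.drop (d + 1)))) = _
    rw [bitsOf_bitsToNat hJ, bitsOf_bitsToNat hI, List.take_append_drop]
  · rintro ⟨⟨s, j, i⟩, rfl⟩
    have hj : (j : ℕ) ≤ d := Nat.le_of_lt_succ j.isLt
    have hA : (bitsOf (d + 1) (j : ℕ)).length = d + 1 := length_bitsOf _ _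
    have e1 : ((label d (s, ⟨j, i⟩)).drop 1).take (d + 1) = bitsOf (d + 1) j := by
      change (bitsOf (d + 1) (j : ℕ) ++ bitsOf (d + 1) (i : ℕ)).take (d + 1) = _
      rw [List.take_left' hA]
    have e2 : ((label d (s, ⟨j, i⟩)).drop (d + 2)).take (d + 1) = bitsOf (d + 1) i := by
      change ((bitsOf (d + 1) (j : ℕ) ++ bitsOf (d + 1) (i : ℕ)).drop (d + 1)).take (d + 1) = _
      rw [List.drop_left' hA, List.take_of_length_le (le_of_eq (length_bitsOf _ _))]
    rw [e1, e2, bitsToNat_bitsOf (j.isLt.trans Nat.lt_two_pow_self),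
      bitsToNat_bitsOf (lt_of_lt_of_le i.isLt (Nat.pow_le_pow_right two_pos (by omega)))]
    exact ⟨⟨length_label _, hj⟩, i.isLt⟩

/-- **Correctness of SIV decryption against the specification `unname`** (adapted from toolkit `NbrBitFP`, piece
G1b): for a candidate label `x` and an acceptance test `c` such that acceptance forces `x` to be a label that
re-encrypts to `y`, and every honest name `y = name v` forces `x = label v` and acceptance, the decision
`if c then 1·x else []` is `1·label v` on `name v` and `[]` on every other string. [folklore] -/
private theorem dec_eq_of' {P : PuncturablePRFScheme} {μ d : ℕ} {k₁ k₂ y : List Bool} (x : List Bool) {c : Prop}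
    [Decidable c] (hc : c → (∃ v, label d v = x) ∧ sivEnc P μ k₁ k₂ x = y)
    (hx : ∀ v, vname P μ k₁ k₂ d v = y → x = label d v ∧ c) :
    (if c then true :: x else []) = ((unname P μ k₁ k₂ d y).map fun v => true :: label d v).getD [] := by
  cases h : unname P μ k₁ k₂ d y with
  | none =>
    rw [Option.map_none, Option.getD_none, if_neg]
    intro hc'
    obtain ⟨⟨v, hv⟩, hy⟩ := hc hc'
    exact (unname_eq_none_iff P μ k₁ k₂ d y).1 h v (by rw [vname, hv]; exact hy)
  | some v =>
    obtain ⟨hxv, hc'⟩ := hx v ((unname_eq_some_iff P μ k₁ k₂ d y v).1 h)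
    rw [Option.map_some, Option.getD_some, if_pos hc', hxv]

/-- **RECOGNISE**: two lookups (mask of the tag part, tag of the unmasked candidate) and the acceptance test agree
with `unname` over the table scheme (correctness of SIV decryption). [cite: Goldreich2004FoC2, Construction 5.4.19] -/
private theorem rec_case (μ d : ℕ) (O : Oracle) (y : List Bool) :
    runProg (fun a : (ℕ × ℕ) × List Bool => primQ a.1.1 a.1.2 a.2) (fun a => primOut a.1.1 a.1.2 a.2) 4 O
        ((μ, d), false :: true :: y) = primSpec μ d (tabOf μ O) (false :: true :: y) := by
  simp only [runProg, progAnswers_four, primQ, primOut, primSpec, List.length_nil, List.length_cons,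
    List.getD_cons_zero, List.getD_cons_succ, ↓reduceIte, zero_add, Nat.reduceEqDiff]
  refine dec_eq_of' _ ?_ ?_
  · rintro ⟨hlen, htag, hlab⟩
    obtain ⟨v, hv⟩ := (isLabelB_iff d _).1 hlab
    have hxl := congrArg List.length hv
    rw [length_label] at hxl
    refine ⟨⟨v, hv⟩, ?_⟩
    rw [sivEnc, tag_tabOf, htag, prf_tabOf, ← hxl, show y.length - μ = labelLen d by omega,
      bxor_bxor_of_length_eq, List.take_append_drop]
    rw [length_fit, List.length_drop]
    omega
  · rintro v rfl
    have hℓ : (label d v).length = labelLen d := length_label v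
    have hlen : (vname (tabScheme (tabOf μ O)) μ (tkey 0) (tkey 1) d v).length = μ + labelLen d :=
      length_vname _ _ _ _ _ _
    have ht : (vname (tabScheme (tabOf μ O)) μ (tkey 0) (tkey 1) d v).take μ =
        fit μ (O (tkey 0 ++ fit μ (label d v))) := by
      rw [vname, sivEnc, List.take_left' (length_tag _ _ _ _), tag_tabOf]
    have hd : (vname (tabScheme (tabOf μ O)) μ (tkey 0) (tkey 1) d v).drop μ =
        ObfuscatedGluedTrees.bxor (label d v)
          (fit (labelLen d) (fit μ (O (tkey 1 ++ fit μ (O (tkey 0 ++ fit μ (label d v))))))) := by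
      rw [vname, sivEnc, List.drop_left' (length_tag _ _ _ _), tag_tabOf, prf_tabOf, fit_fit le_rfl, hℓ]
    have hM : (fit (labelLen d) (fit μ (O (tkey 1 ++ fit μ (O (tkey 0 ++ fit μ (label d v))))))).length =
        (label d v).length := by
      rw [length_fit, hℓ]
    rw [hd, hlen, ht, fit_fit le_rfl, Nat.add_sub_cancel_left, bxor_bxor_of_length_eq hM]
    exact ⟨rfl, rfl, rfl, (isLabelB_iff d _).2 ⟨v, rfl⟩⟩

/-- **PERMUTATION**: the four answers fold to the four list-level Feistel rounds of `prp` over the table scheme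
(forward: rounds `0,1,2,3`, masks `L,H,L,H`; inverse: rounds `3,2,1,0`, masks `H,L,H,L`).
[cite: LubyRackoff1988, main construction] -/
private theorem prp_case (μ d : ℕ) (O : Oracle) (inv tb : Bool) (w : List Bool) :
    runProg (fun a : (ℕ × ℕ) × List Bool => primQ a.1.1 a.1.2 a.2) (fun a => primOut a.1.1 a.1.2 a.2) 4 O
        ((μ, d), true :: inv :: tb :: w) = primSpec μ d (tabOf μ O) (true :: inv :: tb :: w) := by
  simp only [runProg, progAnswers_four, primQ, primOut, primSpec, List.length_nil, List.length_cons,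
    prpFold, prpLookup, zero_add, Nat.reduceAdd]
  have hR : ∀ (r : ℕ) (M W : List Bool),
      (fun (r : ℕ) (M W : List Bool) => ObfuscatedGluedTrees.bxor W (List.zipWith (fun m b => m && b) M
        (fit d (fit μ (O (tkey (if tb = true then 3 else 2) ++ fit μ (bitsOf 8 r ++
          List.zipWith (fun m b => !m && b) M W))))))) r M W =
      ObfuscatedGluedTrees.bxor W (List.zipWith (fun m b => m && b) M
        (prf (tabScheme (tabOf μ O)) μ (tkey (if tb = true then 3 else 2)) d
          (bitsOf 8 r ++ List.zipWith (fun m b => !m && b) M W))) := fun r M W => by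
    rw [prf_tabOf]
  cases inv
  · simp only [Bool.false_eq_true, ↓reduceIte, prpRound_false]
    rw [prpKit_ofFn_prp _ _ _ _ hR, ofFn_vecOf, ofFn_lowHalf_eq, ofFn_highHalf_eq]
  · simp only [↓reduceIte, prpRound_true]
    rw [prpKit_ofFn_prp_symm _ _ _ _ hR, ofFn_vecOf, ofFn_lowHalf_eq, ofFn_highHalf_eq]

/-! ## The registered stub -/

/-- **Stub (layer B, semantics)**: against EVERY oracle `O`, the four-lookup program `primQ` / `primOut` computes the
specification `primSpec μ d (tabOf μ O)` — SIV encryption of a label, recognition of a name, and the keyed Feistel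
permutation (or its inverse) of table `2 + tb`, all over the table scheme of the tables read off `O`.
[cite: Goldreich2004FoC2, Constructions 5.3.9 and 5.4.19] -/
theorem stub_primSem :
    ∀ (μ d : ℕ) (O : Oracle) (body : List Bool),
      runProg (fun a : (ℕ × ℕ) × List Bool => primQ a.1.1 a.1.2 a.2) (fun a => primOut a.1.1 a.1.2 a.2) 4 O
          ((μ, d), body) = primSpec μ d (tabOf μ O) body := by
  intro μ d O body
  match body with
  | [] => rfl
  | [false] => rfl
  | [true] => rfl
  | [true, _] => rfl
  | false :: false :: ℓ => exact enc_case μ d O ℓ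
  | false :: true :: y => exact rec_case μ d O y
  | true :: inv :: tb :: w => exact prp_case μ d O inv tb w

end Summit.QuantumAdvantage.QuantumAdvantage.Theorems.WbwObfuscatedGluedTrees.KnowledgeOfWalk.PrfHybrid

end
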